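import Summits.Langlands.Langlands.Theses.SteinbergArtinDedekind
import Summits.Langlands.Langlands.Theorems.IrreducibilityBySelfDualityIrreducibleOffSectorLanglandsOfReciprocity
import Summits.Langlands.Langlands.Theorems.IrreducibilityBySelfDualityReciprocityUpToIrreducibilityIsobaricRigidity
import Summits.Langlands.Langlands.Theorems.IrreducibilityBySelfDualityReciprocityUpToIrreducibilityDeRhamBlocks
import Summits.Langlands.Langlands.Theorems.IrreducibilityBySelfDualityReciprocityUpToIrreducibilityGeometricConstituents
import Summits.Langlands.Langlands.Theorems.IrreducibilityBySelfDualityIrreducibleOffSectorArtinType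
import Literature.NumberTheory.Automorphic.IsAutomorphicAE
import Literature.NumberTheory.Automorphic.GLnAdelicStructureProofs
import HarnessLib

/-!
# Birth skeleton (BC3) for crux stmt-Langlands-11808
`Summit.Langlands.Langlands.Theses.SteinbergArtinDedekind.SteinbergArtinJunction` — line `birth`

Route `route-Langlands-SteinbergArtinDedekind` (rev 2; deciding theorem
`closes : ArtinWeightLifting → ResidualRegularLift → SteinbergArtinJunction → Langlands`).  The crux is the route's
JUNCTION (auto-crux backfill 2026-08-16, rank 9, "summit-strength: the deciding theorem assumes it and nothing in
the route derives it"):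

  `SteinbergArtinJunction := SteinbergStrongArtin → _root_.Langlands`,

where `X = SteinbergStrongArtin` (the route's target, item stmt-Langlands-11800) is the STEINBERG–ARTIN FAMILY of
conjunct (B): for every prime `ℓ ≥ 5`, every surjective odd `ρ̄ : Γ_ℚ → GL₂(𝔽_ℓ)` and every `σ : Γ_ℚ → GL_ℓ(ℂ)`
carrying the Steinberg character of `ρ̄` (`σ ≅ St_ℓ ∘ ρ̄`), there is a cuspidal `π` on `GL_ℓ(𝔸_ℚ)` with
`π = π(σ)` in Tunnell's sense (Satake–Frobenius matching a.e., `satakePolynomial` normalisation — the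
`IsPiOfArtinRep` shape spelled out).  Refuters ×5 + grounder: target-equivalent by design
(`Langlands → SteinbergArtinJunction := fun h _ => h`), open-problem; no Disproof.lean on the crux
(`ledger crux ls stmt-Langlands-11808`: no workfiles, 2026-08-17).

## The skeleton: `Langlands` along the certified structural seam W / B_w / LGC / JS, B_w cut along the Steinberg–Artin plane

The only typed decomposition of the summit the tree has certified (crux-strategist of `CapacityClassicality.SectorToLanglands`,
stmt-Langlands-10368, `Cruxes/SectorToLanglands/Lines/SectorToLanglandsOfLeaves.lean`, rc 0, 0 sorry — the text form of the landed
decoupling `ReciprocityUpToIrreducibility.reciprocityUpToIrreducibility_of_weak`, p116715; re-used today by the sibling junction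
`HolomorphicShadow.SectorComplement`, stmt-Langlands-14623, `Cruxes/SectorComplement/Lines/birth.lean`) is

  `W → B_w → LGC → JS (2.2) → JS (2.3) → Langlands`

(W = Buzzard–Gee Conj. 3.2.2 weak form: a pinned-geometric avatar, Satake–Frobenius compatible a.e.; B_w = Fontaine–Mazur–Langlands,
a.e. form; LGC = Taylor 2004 Conj. 7 for irreducible pinned-geometric a.e.-compatible pairs, the only clause carrying `∃ Rec`;
JS = Arthur–Clozel Ch. 3 (2.2)/(2.3), the Literature named facts `JacquetShalika1981_partialPairL_boundary_repData` /
`…_pole_repData`).  Its seam is NOT trivial: direction (A) needs the avatar of W to be IRREDUCIBLE — the isobaric bootstrap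
(landed `stub_geometricConstituents` p99702 / `stub_deRhamBlocks` p98936 / `stub_isobaricRigidity` p105601, run with B_w), then the
landed structural theorem `IrreducibleOffSector.langlands_of_reciprocityUpToIrreducibility_text_of_JS` (irreducibility of every
avatar + Chebotarev–Brauer–Nesbitt uniqueness up to conjugacy).

THIS file makes the crux's hypothesis `X` load-bearing by cutting B_w along the **Steinberg–Artin plane** — the sector
`[K:ℚ] = 1 ∧ ρ = ι⁻¹-transport of σ^∨ for some σ : Γ_K → GL_n(ℂ) of Steinberg–Artin type (n prime ≥ 5, σ carries the
Steinberg character of a surjective odd ρ̄ : Γ_K → GL₂(𝔽_n))` — and by separating, on that plane, the FINITE part of (B)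
(which `X` delivers, up to the `ℚ ≅ K` transport and the contragredient/`ι` normalisation, both provable now) from its
ARCHIMEDEAN part (L-algebraicity of Artin-type cusp forms, which `X` does not assert and which is open):

* `stub_weakExistence` — W (open beyond regular algebraic / Shin–HLTT–Scholze; verbatim the sibling child `WeakExistence`);
* `stub_weakAutomorphyOffSteinbergPlane` — B_w OFF the Steinberg–Artin plane (open: Fontaine–Mazur–Langlands for all `n`, all
  `K`, minus the plane);
* `stub_steinbergPlaneOfStrongArtin` — `X →` the FINITE part of B_w ON the plane: **the stub that uses X**.  Content (size M–L,
  provable now): transport `ℚ ≅ K` (`[K:ℚ] = 1`), `X` at `(n, ρ̄, σ)` (the `∃ hcpt` of `X` is proof-irrelevant), and the landed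
  contragredient/`ι` normalisation `IrreducibleOffSector.hasFrobCharpolyAt_of_lAdicDualTransport` /
  `eventually_satakeFrobCompatibleAt_lAdicDualTransport` (roots `ι⁻¹(α_j⁻¹)` of the arithmetic Frobenius, BG Rem. 3.2.5; the kernel
  dictionary `ρ g = 1 ↔ σ g = 1` follows from the matrix formula);
* `stub_isLAlgebraic_of_isPiOfArtinRep` — the ARCHIMEDEAN part: a cuspidal `π` of `GL_n(𝔸_K)` with `π = π(σ)` a.e. for an
  Artin representation `σ` is L-algebraic (`π_∞` of Galois type, parameter `(0,…,0)`; open in general — it contains "Galois-type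
  Maass forms have eigenvalue exactly `¼`"; a consequence of Langlands + Jacquet–Shalika + strong multiplicity one);
* `stub_pairCompatibility` — LGC (open in general; verbatim the sibling child `PairCompatibility`);
* `stub_pairLBoundaryJS`, `stub_pairLPoleJS` — the two Jacquet–Shalika named facts BY NAME (known theorems, Literature T0 debts).

`SteinbergArtinJunction_of` (kernel-checked, no `sorry`; hypotheses = the seven stub statements by name via
`_Goal.stub_x := type_of% @stub_x`): rebuild B_w by a case split on the plane (X discharges the plane through
`stub_steinbergPlaneOfStrongArtin` + `stub_isLAlgebraic_of_isPiOfArtinRep`), then the sibling bootstrap verbatim.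
`lean check`: sorries = the seven stubs, nothing else.

Disproof used: none exists for this crux (`ledger crux ls stmt-Langlands-11808` 2026-08-17: no workfiles; no
`Theorems/SteinbergArtinJunction/Negative/`).  Dead lines: none recorded (first line on this crux).

References: K. Buzzard, T. Gee, LMS LNS 414 (2014), Conj. 3.2.1–3.2.2, Rem. 3.2.5 [BuzzardGeeLMS2014]; J.-M. Fontaine, B. Mazur
(1995), Conj. 1 [FontaineMazurGeometric1995]; R. Taylor, Ann. Fac. Sci. Toulouse 13 (2004), Conj. 7–8
[TaylorGaloisRepresentations2004]; J. Arthur, L. Clozel, Ann. Math. Stud. 120, Ch. 3 §2 (2.2)–(2.3) [ArthurClozelAMS120];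
H. Jacquet, J. Shalika, AJM 103 (1981) [JacquetShalikaAJM1981, JacquetShalikaAJM1981II]; J. Tunnell, Bull. AMS 5 (1981) p. 173
[Tunnell1981]; F. Calegari, The Artin conjecture for some S₅-extensions, Math. Ann. 356 (2013) [Calegari2013ArtinS5];
J. Humphreys, Modular representations of finite groups of Lie type (2005), Ch. 9 [Humphreys2005]; A. Booker, Poles of Artin
L-functions and the strong Artin conjecture, Ann. of Math. 158 (2003) [Booker2003]; F. Calegari, ICM 2022 survey §12 [Calegari2023].
-/

noncomputable section

set_option linter.dupNamespace false -- project-wide option; `Summit.Langlands.Langlands` is the mandated namespace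

open scoped NumberField Classical Polynomial Topology Matrix MatrixGroups
open Filter IsDedekindDomain Polynomial
open Literature.NumberTheory.Automorphic Literature.NumberTheory.GaloisRepresentations
open Summit.Langlands
open Summit.Langlands.Langlands.Theorems.ReciprocityUpToIrreducibility
open Summit.Langlands.Langlands.Theses.SteinbergArtinDedekind (SteinbergStrongArtin SteinbergArtinJunction)

namespace Summit.Langlands.Langlands.Cruxes.SteinbergArtinJunction.Birth

/-! ## 0. The crux, by name -/

/-- The crux IS `X → Langlands`, definitionally. [folklore] -/
theorem steinbergArtinJunction_iff : SteinbergArtinJunction ↔ (SteinbergStrongArtin → _root_.Langlands) :=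
  Iff.rfl

/-! ## 1. The seven stubs (the ONLY sorries of this file) -/

/-- **stub W — weak existence** (Buzzard–Gee Conj. 3.2.2, weak form; OPEN beyond regular algebraic `π` over CM / totally real
`K` — Harris–Lan–Taylor–Thorne 2016 Thm A + Scholze 2015 V.4.2 give the avatar there, de Rham by A'Campo 2024 / Caraiani–Newton in
the crystalline range; nothing for irregular `π` — NonRegularWeightBarrier: weight-one-like / Artin-type infinity types in rank
`≥ 3`, Maass forms — or for `K` neither CM nor totally real, ShimuraVarietyRealizationBarrier): every L-algebraic cuspidal `π` of `GL_n(𝔸_K)` has, for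
all `ℓ, ι`, SOME `ρ : Γ_K → GL_n(ℚ̄_ℓ)` unramified a.e., de Rham above `ℓ` for Fontaine's pinned datum, and Satake–Frobenius
compatible with `π` a.e.  Verbatim the text of the sibling child `CapacityClassicality.WeakExistence`.
Why it might fail: it is direction (A) of the summit in weak form.
[cite: BuzzardGeeLMS2014, Conj. 3.2.2] [cite: FontaineMazurGeometric1995, §1] -/
theorem stub_weakExistence : ∀ (K : Type) [Field K] [NumberField K] (n : ℕ) (hcpt : Literature.NumberTheory.Automorphic.isCompact_glFiniteIntegralLevel n K), 0 < n → ∀ π : Literature.NumberTheory.Automorphic.CuspidalAutomorphicRepData n K hcpt, π.1.IsLAlgebraic → ∀ (ℓ : ℕ) [Fact ℓ.Prime] (ι : PadicAlgCl ℓ ≃+* ℂ), ∃ ρ : Literature.NumberTheory.GaloisRepresentations.FramedGaloisRep K (PadicAlgCl ℓ) n, ((∀ᶠ v : IsDedekindDomain.HeightOneSpectrum (NumberField.RingOfIntegers K) in cofinite, ρ.IsUnramifiedAt v) ∧ ∀ (v : IsDedekindDomain.HeightOneSpectrum (NumberField.RingOfIntegers K)) (hv : ((ℓ : ℕ) : NumberField.RingOfIntegers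 K) ∈ v.asIdeal), (Literature.NumberTheory.PAdicHodge.fontainePstAdicCompletion v ℓ hv).IsDeRhamFramed (ρ.toLocal v)) ∧ ∀ᶠ v : IsDedekindDomain.HeightOneSpectrum (NumberField.RingOfIntegers K) in cofinite, SatakeFrobCompatibleAt ι π.1 ρ v := by
  sorry

/-- **stub B_w⁻ — weak automorphy OFF the Steinberg–Artin plane** (Fontaine–Mazur 1995 Conj. 1 + Langlands, a.e. form, for
every `n ≥ 1` and every number field `K`, EXCEPT on the plane `[K:ℚ] = 1 ∧ ρ = ι⁻¹-transport of σ^∨, σ of Steinberg–Artin type`;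
OPEN — known for odd Artin `GL₂/ℚ` (Khare–Wintenberger 2009), regular Hodge–Tate weights under the automorphy-lifting provisos
(BLGGT 2014, ACC+ 2023), `GL₁` (class field theory); open for irregular weights, `n ≥ 3` non-self-dual, general `K`): every
irreducible `ρ : Γ_K → GL_n(ℚ̄_ℓ)` unramified a.e. and de Rham above `ℓ` (pinned datum), NOT on the plane, has an L-algebraic
cuspidal `π` Satake–Frobenius compatible a.e.  Why it might fail: it is (B) of the summit minus one plane.
[cite: FontaineMazurGeometric1995, Conj. 1] [cite: BuzzardGeeLMS2014, Conj. 3.2.2] [cite: KhareWintenberger2009, Thm. 1.2]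
[cite: BarnetlambEtAl2014, Thm. A] -/
theorem stub_weakAutomorphyOffSteinbergPlane : ∀ (K : Type) [Field K] [NumberField K] (n : ℕ) (hcpt : Literature.NumberTheory.Automorphic.isCompact_glFiniteIntegralLevel n K), 0 < n → ∀ (ℓ : ℕ) [Fact ℓ.Prime] (ι : PadicAlgCl ℓ ≃+* ℂ) (ρ : Literature.NumberTheory.GaloisRepresentations.FramedGaloisRep K (PadicAlgCl ℓ) n), ρ.toGaloisRep.IsIrreducible → ((∀ᶠ v : IsDedekindDomain.HeightOneSpectrum (NumberField.RingOfIntegers K) in cofinite, ρ.IsUnramifiedAt v) ∧ ∀ (v : IsDedekindDomain.HeightOneSpectrum (NumberField.RingOfIntegers K)) (hv : ((ℓ : ℕ) : NumberField.RingOfIntegers K) ∈ v.asIdeal), (Literature.NumberTheory.PAdicHodge.fontainePstAdicCompletion v ℓ hv).IsDeRhamFramed (ρ.toLocal v)) → ¬ (Module.finrank ℚ K = 1 ∧ ∃ σ : Literature.NumberTheory.GaloisRepresentations.FramedArtinRep K n, (n.Prime ∧ 5 ≤ n ∧ ∃ ρbar : Literature.NumberTheory.GaloisRepresentations.FramedGaloisRep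 K (ZMod n) 2, Function.Surjective ρbar ∧ ρbar.IsOdd ∧ ∀ g, ((σ g : Matrix (Fin n) (Fin n) ℂ)).trace = ((Nat.card {w : Fin 2 → ZMod n // w ≠ 0 ∧ ∃ a : ZMod n, ((ρbar g : Matrix (Fin 2) (Fin 2) (ZMod n))).mulVec w = a • w} : ℂ)) / ((n : ℂ) - 1) - 1) ∧ ∀ g : Field.absoluteGaloisGroup K, ((ρ g : GL (Fin n) (PadicAlgCl ℓ)) : Matrix (Fin n) (Fin n) (PadicAlgCl ℓ)) = ((((σ g)⁻¹ : GL (Fin n) ℂ) : Matrix (Fin n) (Fin n) ℂ)ᵀ).map (ι.symm : ℂ → PadicAlgCl ℓ)) → ∃ π : Literature.NumberTheory.Automorphic.CuspidalAutomorphicRepData n K hcpt, π.1.IsLAlgebraic ∧ ∀ᶠ v : IsDedekindDomain.HeightOneSpectrum (NumberField.RingOfIntegers K) in cofinite, SatakeFrobCompatibleAt ι π.1 ρ v := by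
  sorry

/-- **stub B_w⁺(finite) — the Steinberg–Artin plane from `X = SteinbergStrongArtin`** (THE STUB THAT USES `X`; true given `X`,
provable now, size M–L): granted `X`, for every field `K` with `[K:ℚ] = 1`, every `σ : Γ_K → GL_n(ℂ)` of Steinberg–Artin type
(`n` prime `≥ 5`, `σ` carries the Steinberg character `g ↦ #{ρ̄(g)-stable lines in 𝔽_n²} − 1` of a surjective odd
`ρ̄ : Γ_K → GL₂(𝔽_n)`) and every `ρ : Γ_K → GL_n(ℚ̄_ℓ)` which IS the `ι⁻¹`-transport of the contragredient `σ^∨`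
(`ρ(g) = ι⁻¹(((σ g)⁻¹)ᵀ)` entrywise), there is a CUSPIDAL `π` on `GL_n(𝔸_K)` with `π = π(σ)` (Tunnell: `IsPiOfArtinRep σ π.1`)
which is Satake–Frobenius compatible with `(ρ, ι)` a.e. in the summit's normalisation (roots `ι⁻¹(α_j⁻¹)` of the arithmetic
Frobenius).  Proof plan: transport along the unique `ℚ ≃+* K`; `X` at `(ℓ := n, ρ̄, σ)` (its `[Fact n.Prime]` from `n.Prime`, its
`∃ hcpt` proof-irrelevant) gives the cuspidal `π` with `IsPiOfArtinRep σ π.1` verbatim; the kernel dictionary `ρ g = 1 ↔ σ g = 1`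
from the matrix formula; then `IrreducibleOffSector.eventually_satakeFrobCompatibleAt_lAdicDualTransport`.
Why it might fail: only through a transport slip (`ℚ ≅ K` on Galois groups / adelic data), repairable inside the proof.
[cite: Tunnell1981, p. 173] [cite: BuzzardGeeLMS2014, Conj. 3.2.1 and Rem. 3.2.5] [cite: Calegari2013ArtinS5, Thm. 1.2] -/
theorem stub_steinbergPlaneOfStrongArtin : SteinbergStrongArtin → ∀ (K : Type) [Field K] [NumberField K], Module.finrank ℚ K = 1 → ∀ (n : ℕ) (hcpt : Literature.NumberTheory.Automorphic.isCompact_glFiniteIntegralLevel n K) (ℓ : ℕ) [Fact ℓ.Prime] (ι : PadicAlgCl ℓ ≃+* ℂ) (ρ : Literature.NumberTheory.GaloisRepresentations.FramedGaloisRep K (PadicAlgCl ℓ) n) (σ : Literature.NumberTheory.GaloisRepresentations.FramedArtinRep K n), (n.Prime ∧ 5 ≤ n ∧ ∃ ρbar : Literature.NumberTheory.GaloisRepresentations.FramedGaloisRep K (ZMod n) 2, Function.Surjective ρbar ∧ ρbar.IsOdd ∧ ∀ g, ((σ g : Matrix (Fin n) (Fin n) ℂ)).trace = ((Nat.card {w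 : Fin 2 → ZMod n // w ≠ 0 ∧ ∃ a : ZMod n, ((ρbar g : Matrix (Fin 2) (Fin 2) (ZMod n))).mulVec w = a • w} : ℂ)) / ((n : ℂ) - 1) - 1) → (∀ g : Field.absoluteGaloisGroup K, ((ρ g : GL (Fin n) (PadicAlgCl ℓ)) : Matrix (Fin n) (Fin n) (PadicAlgCl ℓ)) = ((((σ g)⁻¹ : GL (Fin n) ℂ) : Matrix (Fin n) (Fin n) ℂ)ᵀ).map (ι.symm : ℂ → PadicAlgCl ℓ)) → ∃ π : Literature.NumberTheory.Automorphic.CuspidalAutomorphicRepData n K hcpt, Literature.NumberTheory.Automorphic.ArtinAutomorphy.IsPiOfArtinRep σ π.1 ∧ ∀ᶠ v : IsDedekindDomain.HeightOneSpectrum (NumberField.RingOfIntegers K) in cofinite, SatakeFrobCompatibleAt ι π.1 ρ v := by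
  sorry

/-- **stub B_w⁺(∞) — Artin-type cusp forms are L-algebraic** (the ARCHIMEDEAN part of (B) on the plane, stated in its natural
generality; OPEN): if a cuspidal automorphic representation `π` of `GL_n(𝔸_K)`, `n ≥ 1`, satisfies `π = π(σ)` in Tunnell's sense
(`IsPiOfArtinRep σ π.1`: at almost every place `π_v` is unramified with Satake parameter `α_v` and `charpoly σ(Frob_v) = ∏ (X − a)`,
`a ∈ α_v`) for SOME Artin representation `σ : Γ_K → GL_n(ℂ)`, then `π` is L-algebraic (Buzzard–Gee Def. 3.1.1: an infinity type
with integral exponents — here `(0,…,0)`, `π_∞ ↔ σ|_{W_{K_v}}`).  Known: `n = 1` (finite-order Hecke characters, class field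
theory); `n = 2` over `ℚ` whenever `σ` is already known automorphic — `σ` odd (Khare–Wintenberger) or of soluble image
(Langlands–Tunnell) — by strong multiplicity one with `π(σ)`; OPEN for even icosahedral `σ` ("a Galois-type Maass form has Laplace
eigenvalue exactly `¼`"; Booker 2003, p. 1090: no even example of strong Artin is known beyond the soluble ones) and open in rank
`≥ 3` in general, in particular on the Steinberg–Artin plane (`n = ℓ ≥ 5`: `X` produces `π` but says nothing at `∞`).  A consequence
of the summit: (B) for `ι⁻¹σ^∨` + Jacquet–Shalika + strong multiplicity one.
Why it might fail: an archimedean rigidity statement with no finite-place handle; no counterexample is known or expected.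
[cite: BuzzardGeeLMS2014, Def. 3.1.1 and Conj. 3.2.2] [cite: KhareWintenberger2009, Thm. 1.2] [cite: Booker2003, p. 1090]
[cite: Tunnell1981, p. 173] [cite: Calegari2023, §12] -/
theorem stub_isLAlgebraic_of_isPiOfArtinRep : ∀ (K : Type) [Field K] [NumberField K] (n : ℕ) (hcpt : Literature.NumberTheory.Automorphic.isCompact_glFiniteIntegralLevel n K) (π : Literature.NumberTheory.Automorphic.CuspidalAutomorphicRepData n K hcpt) (σ : Literature.NumberTheory.GaloisRepresentations.FramedArtinRep K n), 0 < n → Literature.NumberTheory.Automorphic.ArtinAutomorphy.IsPiOfArtinRep σ π.1 → π.1.IsLAlgebraic := by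
  sorry

/-- **stub LGC — local–global compatibility for compatible pairs** (Taylor 2004 Conj. 7 at EVERY finite place, through the
Grothendieck–Deligne recipe at `v ∤ ℓ` and Fontaine's pinned `D_pst` at `v ∣ ℓ`, for ONE reciprocity datum `Rec` per field —
the only clause carrying `∃ Rec`; OPEN in general: known for regular algebraic conjugate self-dual `π` over CM fields
(Harris–Taylor, Taylor–Yoshida, Caraiani) and `ℓ ≠ p` beyond (Varma), open for irregular `π` and at `v ∣ ℓ` in general; includes
the Harris–Taylor debt `LocalLanglandsDatum` of `Rec` itself): verbatim the text of the sibling child `CapacityClassicality.PairCompatibility`.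
On the Steinberg–Artin plane this is exactly the crux docstring's "upgrade of a.e. Satake matching to `Corresponds`".
Why it might fail: a.e.-compatible irreducible pairs with a local mismatch at a ramified place would refute it (none known).
[cite: TaylorGaloisRepresentations2004, Conj. 7] [cite: HarrisTaylorAMS2001, Thm. A] -/
theorem stub_pairCompatibility : ∀ (K : Type) [Field K] [NumberField K], ∃ Rec : ReciprocityData K, ∀ (n : ℕ) (hcpt : Literature.NumberTheory.Automorphic.isCompact_glFiniteIntegralLevel n K), 0 < n → ∀ (π : Literature.NumberTheory.Automorphic.CuspidalAutomorphicRepData n K hcpt), π.1.IsLAlgebraic → ∀ (ℓ : ℕ) [Fact ℓ.Prime] (ι : PadicAlgCl ℓ ≃+* ℂ) (ρ : Literature.NumberTheory.GaloisRepresentations.FramedGaloisRep K (PadicAlgCl ℓ) n), ρ.toGaloisRep.IsIrreducible → ((∀ᶠ v : IsDedekindDomain.HeightOneSpectrum (NumberField.RingOfIntegers K) in cofinite, ρ.IsUnramifiedAt v) ∧ ∀ (v : IsDedekindDomain.HeightOneSpectrum (NumberField.RingOfIntegers K)) (hv : ((ℓ : ℕ) : NumberField.RingOfIntegers K) ∈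 v.asIdeal), (Literature.NumberTheory.PAdicHodge.fontainePstAdicCompletion v ℓ hv).IsDeRhamFramed (ρ.toLocal v)) → (∀ᶠ v : IsDedekindDomain.HeightOneSpectrum (NumberField.RingOfIntegers K) in cofinite, SatakeFrobCompatibleAt ι π.1 ρ v) → ∀ v : IsDedekindDomain.HeightOneSpectrum (NumberField.RingOfIntegers K), LocalGlobalCompatibleAt Rec ι π.1 ρ v := by
  sorry

/-- **stub JS (2.2)** — Jacquet–Shalika / Arthur–Clozel Ch. 3 (2.2) for Borel–Jacquet data, the Literature named fact BY NAME
(a THEOREM of the literature, a T0 debt of the tree hanging on its `L²` leaves; = item stmt-Langlands-13622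
`IrreducibilityBySelfDuality.PairLBoundaryJS` definitionally).  [cite: ArthurClozelAMS120, Ch. 3 §2 (2.2)]
[cite: JacquetShalikaAJM1981II, Prop. 3.6 and Thm. 4.4] -/
theorem stub_pairLBoundaryJS : Literature.NumberTheory.Automorphic.JacquetShalika1981_partialPairL_boundary_repData := by
  sorry

/-- **stub JS (2.3)** — Jacquet–Shalika / Arthur–Clozel Ch. 3 (2.3) for Borel–Jacquet data, the Literature named fact BY NAME
(a THEOREM of the literature; T0 debt hanging on the single `L²` leaf `JacquetShalika1981_partialPairL_pole_of_eq_conj`; rank one is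
already the theorem `…_pole_repData_one`).  [cite: ArthurClozelAMS120, Ch. 3 §2 (2.3)] [cite: JacquetShalikaAJM1981II, Prop. 3.6] -/
theorem stub_pairLPoleJS : Literature.NumberTheory.Automorphic.JacquetShalika1981_partialPairL_pole_repData := by
  sorry

/-! ## 2. The stub statements as named propositions (hypotheses of the composition, admissible by stub name)

Each `_Goal.stub_x` is `type_of% @stub_x`: literally the stub's statement, no text duplicated, no `sorry` inherited. -/

namespace _Goal

/-- The statement of `stub_weakExistence` (literally its type). [folklore] -/
def stub_weakExistence : Prop :=
  type_of% @Summit.Langlands.Langlands.Cruxes.SteinbergArtinJunction.Birth.stub_weakExistence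

/-- The statement of `stub_weakAutomorphyOffSteinbergPlane` (literally its type). [folklore] -/
def stub_weakAutomorphyOffSteinbergPlane : Prop :=
  type_of% @Summit.Langlands.Langlands.Cruxes.SteinbergArtinJunction.Birth.stub_weakAutomorphyOffSteinbergPlane

/-- The statement of `stub_steinbergPlaneOfStrongArtin` (literally its type). [folklore] -/
def stub_steinbergPlaneOfStrongArtin : Prop :=
  type_of% @Summit.Langlands.Langlands.Cruxes.SteinbergArtinJunction.Birth.stub_steinbergPlaneOfStrongArtin

/-- The statement of `stub_isLAlgebraic_of_isPiOfArtinRep` (literally its type). [folklore] -/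
def stub_isLAlgebraic_of_isPiOfArtinRep : Prop :=
  type_of% @Summit.Langlands.Langlands.Cruxes.SteinbergArtinJunction.Birth.stub_isLAlgebraic_of_isPiOfArtinRep

/-- The statement of `stub_pairCompatibility` (literally its type). [folklore] -/
def stub_pairCompatibility : Prop :=
  type_of% @Summit.Langlands.Langlands.Cruxes.SteinbergArtinJunction.Birth.stub_pairCompatibility

/-- The statement of `stub_pairLBoundaryJS` (literally its type). [folklore] -/
def stub_pairLBoundaryJS : Prop :=
  type_of% @Summit.Langlands.Langlands.Cruxes.SteinbergArtinJunction.Birth.stub_pairLBoundaryJS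

/-- The statement of `stub_pairLPoleJS` (literally its type). [folklore] -/
def stub_pairLPoleJS : Prop :=
  type_of% @Summit.Langlands.Langlands.Cruxes.SteinbergArtinJunction.Birth.stub_pairLPoleJS

end _Goal

/-! ## 3. The composition (kernel-checked, no `sorry`):
W → B_w⁻ → (X → B_w⁺ finite) → B_w⁺(∞) → LGC → JS (2.2) → JS (2.3) → SteinbergArtinJunction -/

/-- **`SteinbergArtinJunction` from its seven stubs.**  Given `X` (the crux's antecedent), B_w is rebuilt from its two halves by a
case split on the Steinberg–Artin plane (`X` discharges the finite part of the plane through `stub_steinbergPlaneOfStrongArtin`,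
the archimedean clause is `stub_isLAlgebraic_of_isPiOfArtinRep`); then, verbatim, the sibling's isobaric bootstrap (irreducibility
of W's avatar: geometric constituents + de Rham heredity, B_w on the constituents, Jacquet–Shalika rigidity), the packaging of
reciprocity-up-to-irreducibility for the `Rec` of LGC, and the landed structural
`IrreducibleOffSector.langlands_of_reciprocityUpToIrreducibility_text_of_JS`.  Hypotheses = the seven stub statements by name;
conclusion = the route decl by name.  [cite: BuzzardGeeLMS2014, Conj. 3.2.1 and Conj. 3.2.2]
[cite: ArthurClozelAMS120, Ch. 3 §2 (2.2)–(2.3)] [cite: CalegariGee2013, §1.1] [cite: DeligneSerreASENS1974, Lemme 3.2] -/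
theorem SteinbergArtinJunction_of (hW : _Goal.stub_weakExistence) (hOff : _Goal.stub_weakAutomorphyOffSteinbergPlane)
    (hOn : _Goal.stub_steinbergPlaneOfStrongArtin) (hArch : _Goal.stub_isLAlgebraic_of_isPiOfArtinRep)
    (hL : _Goal.stub_pairCompatibility) (hJSb : _Goal.stub_pairLBoundaryJS) (hJSp : _Goal.stub_pairLPoleJS) :
    SteinbergArtinJunction := by
  rw [steinbergArtinJunction_iff]
  intro hX
  dsimp only [_Goal.stub_weakExistence, _Goal.stub_weakAutomorphyOffSteinbergPlane, _Goal.stub_steinbergPlaneOfStrongArtin,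
    _Goal.stub_isLAlgebraic_of_isPiOfArtinRep, _Goal.stub_pairCompatibility, _Goal.stub_pairLBoundaryJS,
    _Goal.stub_pairLPoleJS] at hW hOff hOn hArch hL hJSb hJSp
  -- B_w (Fontaine–Mazur–Langlands, a.e. form) from its two halves: the Steinberg–Artin plane is discharged by X
  have hB : ∀ (K : Type) [Field K] [NumberField K] (n : ℕ) (hcpt : Literature.NumberTheory.Automorphic.isCompact_glFiniteIntegralLevel n K), 0 < n → ∀ (ℓ : ℕ) [Fact ℓ.Prime] (ι : PadicAlgCl ℓ ≃+* ℂ) (ρ : Literature.NumberTheory.GaloisRepresentations.FramedGaloisRep K (PadicAlgCl ℓ) n), ρ.toGaloisRep.IsIrreducible → ((∀ᶠ v : IsDedekindDomain.HeightOneSpectrum (NumberField.RingOfIntegers K) in cofinite, ρ.IsUnramifiedAt v) ∧ ∀ (v : IsDedekindDomain.HeightOneSpectrum (NumberField.RingOfIntegers K)) (hv : ((ℓ : ℕ) : NumberField.RingOfIntegers K) ∈ v.asIdeal), (Literature.NumberTheory.PAdicHodge.fontainePstAdicCompletion v ℓ hv).IsDeRhamFramed (ρ.toLocal v)) → ∃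 π : Literature.NumberTheory.Automorphic.CuspidalAutomorphicRepData n K hcpt, π.1.IsLAlgebraic ∧ ∀ᶠ v : IsDedekindDomain.HeightOneSpectrum (NumberField.RingOfIntegers K) in cofinite, SatakeFrobCompatibleAt ι π.1 ρ v := by
    intro K _ _ n hcpt hn ℓ _ ι ρ hirr hgeo
    by_cases hs : (Module.finrank ℚ K = 1 ∧ ∃ σ : Literature.NumberTheory.GaloisRepresentations.FramedArtinRep K n, (n.Prime ∧ 5 ≤ n ∧ ∃ ρbar : Literature.NumberTheory.GaloisRepresentations.FramedGaloisRep K (ZMod n) 2, Function.Surjective ρbar ∧ ρbar.IsOdd ∧ ∀ g, ((σ g : Matrix (Fin n) (Fin n) ℂ)).trace = ((Nat.card {w : Fin 2 → ZMod n // w ≠ 0 ∧ ∃ a : ZMod n, ((ρbar g : Matrix (Fin 2) (Fin 2) (ZMod n))).mulVec w = a • w} : ℂ)) / ((n : ℂ) - 1) - 1) ∧ ∀ g : Field.absoluteGaloisGroup K, ((ρ g : GL (Fin n) (PadicAlgCl ℓ)) : Matrix (Fin n) (Fin n) (PadicAlgCl ℓ)) = ((((σ g)⁻¹ : GL (Fin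 n) ℂ) : Matrix (Fin n) (Fin n) ℂ)ᵀ).map (ι.symm : ℂ → PadicAlgCl ℓ))
    · obtain ⟨hK, σ, hσ, hρσ⟩ := hs
      obtain ⟨π, hπσ, hcompat⟩ := hOn hX K hK n hcpt ℓ ι ρ σ hσ hρσ
      exact ⟨π, hArch K n hcpt π σ hn hπσ, hcompat⟩
    · exact hOff K n hcpt hn ℓ ι ρ hirr hgeo hs
  -- the isobaric bootstrap, run with B_w: a pinned-geometric avatar of a cuspidal `π` is irreducible
  have irr : ∀ (K : Type) [Field K] [NumberField K] (n : ℕ) (hcpt : isCompact_glFiniteIntegralLevel n K)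
      (_ : 0 < n) (π : CuspidalAutomorphicRepData n K hcpt) (ℓ : ℕ) [Fact ℓ.Prime]
      (ι : PadicAlgCl ℓ ≃+* ℂ) (ρ : FramedGaloisRep K (PadicAlgCl ℓ) n),
      ((∀ᶠ v : HeightOneSpectrum (𝓞 K) in cofinite, ρ.IsUnramifiedAt v) ∧
        ∀ (v : HeightOneSpectrum (𝓞 K)) (hv : ((ℓ : ℕ) : 𝓞 K) ∈ v.asIdeal),
          (Literature.NumberTheory.PAdicHodge.fontainePstAdicCompletion v ℓ hv).IsDeRhamFramed
            (ρ.toLocal v)) →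
      (∀ᶠ v : HeightOneSpectrum (𝓞 K) in cofinite, SatakeFrobCompatibleAt ι π.1 ρ v) →
        ρ.toGaloisRep.IsIrreducible := by
    intro K _ _ n hcpt hn π ℓ _ ι ρ hgeo hρ
    obtain ⟨k, m, r, hr, hchar, -, hone⟩ :=
      stub_geometricConstituents stub_deRhamBlocks K ℓ n ρ hn hgeo
    by_cases hk1 : k = 1
    · exact hone hk1
    have hk0 : k ≠ 0 := by
      rintro rfl
      have h1 := hchar 1
      simp only [Finset.univ_eq_empty, Finset.prod_empty] at h1
      have hdeg : (FramedRep.charpoly ρ 1).natDegree = n := by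
        simp [FramedRep.charpoly, Matrix.charpoly_natDegree_eq_dim]
      rw [h1, natDegree_one] at hdeg
      omega
    have hk2 : 2 ≤ k := by omega
    have hσ : ∀ i, ∃ σ : CuspidalAutomorphicRepData (m i) K
        (isCompact_glFiniteIntegralLevel_holds (m i) K),
        ∀ᶠ v : HeightOneSpectrum (𝓞 K) in cofinite, SatakeFrobCompatibleAt ι σ.1 (r i) v := by
      intro i
      obtain ⟨σ, -, hcorr⟩ := hB K (m i) (isCompact_glFiniteIntegralLevel_holds (m i) K) (hr i).1 ℓ ι
        (r i) (hr i).2.1 (hr i).2.2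
      exact ⟨σ, hcorr⟩
    choose σ hσc using hσ
    refine (stub_isobaricRigidity hJSb hJSp K n hcpt π k m
      (fun i => isCompact_glFiniteIntegralLevel_holds (m i) K) σ hn hk2 (fun i => (hr i).1) ?_).elim
    have hall : ∀ᶠ v : HeightOneSpectrum (𝓞 K) in cofinite,
        ∀ i, SatakeFrobCompatibleAt ι (σ i).1 (r i) v :=
      Filter.eventually_all.mpr hσc
    filter_upwards [hρ, hall] with v hv hvi
    intro α hα
    obtain ⟨α₀, hα₀, -, hcp⟩ := hv
    obtain rfl : α = α₀ := AutomorphicRepData.hasSatakeParamAt_unique_holds π.1 hα hα₀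
    choose β hβ _hurβ hcpβ using hvi
    refine ⟨β, hβ, ?_⟩
    have hprod : ρ.HasFrobCharpolyAt v (∏ i, arithFrobPolyOfSatake ι v.residueCard 1 (β i)) := by
      intro 𝔓 h𝔓 τ hτ
      rw [hchar τ]
      exact Finset.prod_congr rfl fun i _ => hcpβ i 𝔓 h𝔓 τ hτ
    rw [← Summit.Langlands.Langlands.Theorems.IrreducibleOffSector.arithFrobPolyOfSatake_sum] at hprod
    have heq : arithFrobPolyOfSatake ι v.residueCard 1 α =
        arithFrobPolyOfSatake ι v.residueCard 1 (∑ i, β i) :=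
      GaloisRep.HasFrobCharpolyAt.unique_holds
        ((FramedGaloisRep.hasFrobCharpolyAt_toGaloisRep_iff v _ ρ).mpr hcp)
        ((FramedGaloisRep.hasFrobCharpolyAt_toGaloisRep_iff v _ ρ).mpr hprod)
    exact arithFrobPolyOfSatake_one_injective ι _ heq
  -- reciprocity up to irreducibility (the text of crux stmt-Langlands-14328) for the `Rec` of LGC
  have hE : ∀ (F : Type) [Field F] [NumberField F], ∃ Rec : ReciprocityData F, ∀ n : ℕ, 0 < n →
      ∀ hcpt : isCompact_glFiniteIntegralLevel n F,
        (∀ π : CuspidalAutomorphicRepData n F hcpt, π.1.IsLAlgebraic →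
          ∀ (ℓ : ℕ) [Fact ℓ.Prime] (ι : PadicAlgCl ℓ ≃+* ℂ),
            ∃ ρ : FramedGaloisRep F (PadicAlgCl ℓ) n, IsGeometricFramed Rec ρ ∧ Corresponds Rec ι π.1 ρ) ∧
        GaloisToAutomorphic n Rec hcpt := by
    intro F _ _
    obtain ⟨Rec, hRec⟩ := hL F
    refine ⟨Rec, fun n hn hcpt => ⟨fun π hLalg ℓ _ ι => ?_, fun ℓ _ ι ρ hirr hgeo => ?_⟩⟩
    · obtain ⟨ρ, hgeo, hρ⟩ := hW F n hcpt hn π hLalg ℓ ι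
      have hirr : ρ.toGaloisRep.IsIrreducible := irr F n hcpt hn π ℓ ι ρ hgeo hρ
      exact ⟨ρ, hgeo, hρ, hRec n hcpt hn π hLalg ℓ ι ρ hirr hgeo hρ⟩
    · obtain ⟨π, hLalg, hρ⟩ := hB F n hcpt hn ℓ ι ρ hirr hgeo
      exact ⟨π, hLalg, hρ, hRec n hcpt hn π hLalg ℓ ι ρ hirr hgeo hρ⟩
  -- the summit: irreducibility of every avatar and Chebotarev–Brauer–Nesbitt uniqueness (landed, structural)
  exact Summit.Langlands.Langlands.Theorems.IrreducibleOffSector.langlands_of_reciprocityUpToIrreducibility_text_of_JS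
    hJSb hJSp hE

/-- By-name sanity check (an `example`, not a declaration): the seven stubs feed the composition as they stand. -/
example : SteinbergArtinJunction :=
  SteinbergArtinJunction_of stub_weakExistence stub_weakAutomorphyOffSteinbergPlane stub_steinbergPlaneOfStrongArtin
    stub_isLAlgebraic_of_isPiOfArtinRep stub_pairCompatibility stub_pairLBoundaryJS stub_pairLPoleJS

end Summit.Langlands.Langlands.Cruxes.SteinbergArtinJunction.Birth

end
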